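import Literature.AlgebraicGeometry.Morphisms.FormalModuleCompletion
import Literature.AlgebraicGeometry.Morphisms.FormalModuleCokernel
import HarnessLib

/-!
# Completion commutes with cokernels: `coker(v)/aⁿ⁺¹ ≅ coker(M/aⁿ⁺¹M → N/aⁿ⁺¹N)`

Görtz–Wedhorn, *Algebraic Geometry II* (2023), Rem. 24.87 / (24.18.4) (p. 563: `ℱ ↦ ℱ_{/Z}` is exact)
and Lemma 24.101 (1) (p. 569: the cokernel of a morphism between algebraizable modules is
algebraizable). In the tower language of `Morphisms/FormalModuleCompletion` (completion `cmplTower a M`,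
`cmplMap a v`) and `Morphisms/FormalModuleCokernel` (levelwise cokernels `cokerTower`):

* `cmplMapApp_zero`, `cmplMapApp_comp_eq` — bookkeeping;
* `cokernelCmplMapAppIso a v n : cokernel (cmplMapApp a v n) ≅ cmplObj a (cokernel v) n` — **the
  level-`n` cokernel of the completion of `v : M → N` is the level `n` of the completion of
  `coker v`** (both are `N/(aⁿ⁺¹N + v(M))`; right exactness of `– ⊗ 𝒪_X/aⁿ⁺¹`), with the
  compatibilities `cokernel_π_cokernelCmplMapAppIso_hom`, `cmplπ_desc_cokernelCmplMapAppIso_inv`;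
* `cokerTowerCmplMapIso a v n : (cokerTower (cmplMap a v)).obj ⟨n⟩ ≅ (cmplTower a (cokernel v)).obj ⟨n⟩`
  — the same, for the levels of the cokernel tower: **the cokernel (in formal towers) of a morphism
  between completions is, levelwise, the completion of the cokernel**, which is how a presentation
  `𝒪(-m')^{r'} → 𝒪(-m)^r → ℱ → 0` of a coherent formal module algebraizes `ℱ` (Lemma 24.101 (1)).

Everything is proved; no named facts.

## References

* U. Görtz, T. Wedhorn, *Algebraic Geometry II: Cohomology of Schemes*, Springer Spektrum (2023),
  Rem. 24.87, (24.18.4) (p. 563), Lemma 24.101 (1) (p. 569). [GortzWedhorn2023]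
* A. Grothendieck, EGA III₁ (1961), 5.1. [EGAIII1]
-/

noncomputable section

open CategoryTheory AlgebraicGeometry Limits TopologicalSpace Opposite
open Literature.AlgebraicGeometry.Modules

universe u

namespace Literature.AlgebraicGeometry.Morphisms

variable {X : Scheme.{u}} (a : Γ(X, ⊤)) {M N : X.Modules} (v : M ⟶ N)

/-- `cmplMapApp` of the zero morphism vanishes. [folklore] -/
theorem cmplMapApp_zero (n : ℕ) : cmplMapApp a (0 : M ⟶ N) n = 0 := by
  rw [← cancel_epi (cmplπ a M n), cmplπ_cmplMapApp, zero_comp, comp_zero]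

/-- `M/aⁿ⁺¹ → N/aⁿ⁺¹ → coker(v)/aⁿ⁺¹` vanishes. [folklore] -/
theorem cmplMapApp_comp_cokernel_π (n : ℕ) :
    cmplMapApp a v n ≫ cmplMapApp a (cokernel.π v) n = 0 := by
  rw [← cmplMapApp_comp, cokernel.condition, cmplMapApp_zero]

/-- `M → N → N/aⁿ⁺¹ → coker(M/aⁿ⁺¹ → N/aⁿ⁺¹)` vanishes. [folklore] -/
theorem comp_cmplπ_comp_cokernel_π (n : ℕ) :
    v ≫ cmplπ a N n ≫ cokernel.π (cmplMapApp a v n) = 0 := by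
  rw [← cmplπ_cmplMapApp_assoc, cokernel.condition, comp_zero]

/-- The map `coker v → coker(M/aⁿ⁺¹ → N/aⁿ⁺¹)` induced by `N → N/aⁿ⁺¹`. [folklore] -/
def cokernelToCokernelCmplMapApp (n : ℕ) : cokernel v ⟶ cokernel (cmplMapApp a v n) :=
  cokernel.desc v (cmplπ a N n ≫ cokernel.π (cmplMapApp a v n)) (comp_cmplπ_comp_cokernel_π a v n)

/-- Its defining property. [folklore] -/
@[reassoc (attr := simp)]
theorem π_cokernelToCokernelCmplMapApp (n : ℕ) :
    cokernel.π v ≫ cokernelToCokernelCmplMapApp a v n = cmplπ a N n ≫ cokernel.π (cmplMapApp a v n) :=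
  cokernel.π_desc _ _ _

/-- `aⁿ⁺¹` dies on `coker(M/aⁿ⁺¹ → N/aⁿ⁺¹)` through `coker v`. [folklore] -/
theorem globalScalar_comp_cokernelToCokernelCmplMapApp (n : ℕ) :
    globalScalar (cokernel v) (a ^ (n + 1)) ≫ cokernelToCokernelCmplMapApp a v n = 0 := by
  rw [← cancel_epi (cokernel.π v), ← globalScalar_comp_assoc, π_cokernelToCokernelCmplMapApp, comp_zero,
    ← Category.assoc, cokernel.condition, zero_comp]

/-- **`coker(M/aⁿ⁺¹M → N/aⁿ⁺¹N) ≅ coker(v)/aⁿ⁺¹`**: completion commutes with cokernels, levelwise.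
[cite: GortzWedhorn2023, Rem. 24.87 and Lemma 24.101 (1) (pp. 563, 569)] -/
def cokernelCmplMapAppIso (n : ℕ) : cokernel (cmplMapApp a v n) ≅ cmplObj a (cokernel v) n where
  hom := cokernel.desc _ (cmplMapApp a (cokernel.π v) n) (cmplMapApp_comp_cokernel_π a v n)
  inv := cokernel.desc _ (cokernelToCokernelCmplMapApp a v n)
    (globalScalar_comp_cokernelToCokernelCmplMapApp a v n)
  hom_inv_id := by
    rw [← cancel_epi (cokernel.π (cmplMapApp a v n)), cokernel.π_desc_assoc, Category.comp_id,
      ← cancel_epi (cmplπ a N n), cmplπ_cmplMapApp_assoc, cokernel.π_desc, π_cokernelToCokernelCmplMapApp]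
  inv_hom_id := by
    rw [← cancel_epi (cmplπ a (cokernel v) n), cokernel.π_desc_assoc, Category.comp_id,
      ← cancel_epi (cokernel.π v), π_cokernelToCokernelCmplMapApp_assoc, cokernel.π_desc,
      cmplπ_cmplMapApp]

/-- Compatibility of `cokernelCmplMapAppIso` with the quotient maps from `N/aⁿ⁺¹N`. [folklore] -/
@[reassoc (attr := simp)]
theorem cokernel_π_cokernelCmplMapAppIso_hom (n : ℕ) :
    cokernel.π (cmplMapApp a v n) ≫ (cokernelCmplMapAppIso a v n).hom = cmplMapApp a (cokernel.π v) n :=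
  cokernel.π_desc _ _ _

/-- Compatibility of the inverse with the quotient maps from `coker v`. [folklore] -/
@[reassoc (attr := simp)]
theorem cmplπ_cokernelCmplMapAppIso_inv (n : ℕ) :
    cmplπ a (cokernel v) n ≫ (cokernelCmplMapAppIso a v n).inv = cokernelToCokernelCmplMapApp a v n :=
  cokernel.π_desc _ _ _

/-- **The cokernel tower of a morphism of completions is, levelwise, the completion of the
cokernel.** [cite: GortzWedhorn2023, Lemma 24.101 (1) (p. 569)] -/
def cokerTowerCmplMapIso (n : ℕ) :
    (cokerTower (cmplMap a v)).obj ⟨n⟩ ≅ (cmplTower a (cokernel v)).obj ⟨n⟩ :=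
  cokernelCmplMapAppIso a v n

/-- In particular a formal tower whose levels are those of `cokerTower (cmplMap a v)` has levels
`coker(v)/aⁿ⁺¹ coker(v)`. [folklore] -/
theorem nonempty_iso_cmplObj_cokernel (n : ℕ) :
    Nonempty ((cokerTower (cmplMap a v)).obj ⟨n⟩ ≅ cmplObj a (cokernel v) n) :=
  ⟨cokerTowerCmplMapIso a v n⟩

end Literature.AlgebraicGeometry.Morphisms

end
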